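import Literature.Computability.Complexity.MurrayWilliams2018AlmostAE
import HarnessLib

/-!
# Murray–Williams 2018, Theorem 3.1: the advice `αₙ`, the language `L₁`, and its "almost"
# almost-everywhere hardness as a closed statement

Companion of `MurrayWilliams2018AlmostAE.lean`, which proves the hardness analysis of
Murray–Williams 2018, Thm. 3.1 (C. D. Murray, R. R. Williams, *Circuit lower bounds for
nondeterministic quasi-polytime: an easy witness lemma for NP and NQP*, STOC 2018 / ECCC TR17-188,
§3) for abstract data `α` (advice) and `L₁` (the language of the Merlin–Arthur protocol `M₁`)
subject to interface hypotheses. The printed proof fixes both objects outright — they do not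
depend on how the protocol is programmed, only on WHAT it decides under its promise:

* display (1)–(2): `ℓ(n) :=` the largest `ℓ` such that `L^ℓ_PSPACE` has a circuit of size at most
  `s₁(n)`, `αₙ := min{s₂(n), ℓ(n)}` — here `advice Lstar s₁ s₂ n`, the largest `ℓ ≤ s₂(n)` with
  `Lstar.circuitSize ℓ ≤ s₁(n)` (`Nat.findGreatest`);
* the protocol (ECCC p. 10): on `y` of length `n`, "If `αₙ = s₂(n)`: simulate `L_diag` on `y` …
  Otherwise (`αₙ < s₂(n)`): parse `y = 1ᵃ0x`. If `|x| + 1 > αₙ` then reject. … Output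
  `M^C(1^{αₙ-|x|-1}0x)`", which under the MA promise (guaranteed by the advice) and the
  checkability of `L_PSPACE` decides exactly the language `hardLang Lstar Ldiag s₁ s₂` below.

With these definitions the hardness half of Thm. 3.1 becomes a closed theorem about an explicit
language, `eventually_lt_circuitSize_hardLang_or`: for every language `Lstar` that is paddable
(`1z ∈ Lstar ⟺ z ∈ Lstar`), has no all-ones word, and is downward self-reducible in circuit form
with overhead `D`, every `Ldiag` without `s(n)`-size circuits at large lengths, and size
functions with `n ≤ s₂(n)`, (ii) `s(s₂ n) + 2 ≤ s₁(n)`, (iii) `D ℓ (s(m) + 2) ≤ s₁(m)` (`ℓ < m`)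
eventually, the language `hardLang Lstar Ldiag s₁ s₂` has, for all large `n`, circuit complexity
`> s(n)` at length `n` or `> s(s₂ n)` at length `s₂ n`. What then remains of Thm. 3.1 for a
concrete complete language (Santhanam's `L_PSPACE`, Thm. 2.2, or any paddable, downward
self-reducible, same-length checkable language to which `Ldiag` reduces) is the upper bound:
`hardLang … ∈ MATIME[O(s₁² s₂^{d₃})]` with `2 log s₂(n)` advice and the promise on all lengths.

The diagonal language itself (Thm. 2.3: a language without `s(n)`-size circuits at every large
length) is supplied separately (`CountingDiagonalization.lean`, `GreedyHard.diag`, hard at every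
length `n` with `30 ≤ s(n)` and `(s(n)+4)² ≤ 2ⁿ`); here it stays the parameter `Ldiag` with the
hypothesis `hdiag`, since the upper-bound half must also reduce it to `Lstar`.

Definitions with bodies and theorems only; no named fact is introduced.

## References

* C. D. Murray, R. R. Williams, *Circuit lower bounds for nondeterministic quasi-polytime: an easy
  witness lemma for NP and NQP*, STOC 2018 (ECCC TR17-188), §3 (Thm. 3.1, displays (1)–(2),
  the protocol `M₁`, Proposition 1, Lemma 3.1) [MurrayWilliams2018].
-/

noncomputable section

namespace Literature.Computability.Complexity

open Filter

namespace AlmostAE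

/-! ### The advice `αₙ` (displays (1)–(2)) -/

/-- **Murray–Williams' advice** `αₙ := min{s₂(n), ℓ(n)}`, `ℓ(n) :=` the largest `ℓ` such that
`L^ℓ_PSPACE` has a circuit of size at most `s₁(n)` (Thm. 3.1, displays (1)–(2)); over the tree:
the largest `ℓ ≤ s₂(n)` with `Lstar.circuitSize ℓ ≤ s₁(n)` (`0` if none, which does not happen
for `s₁(n) ≥ 1`). "Note that `αₙ` can be encoded in at most `2 log s₂(n)` bits."
[cite: MurrayWilliams2018, Thm. 3.1 (displays (1)–(2))] -/
def advice (Lstar : Language Bool) (s₁ s₂ : ℕ → ℕ) (n : ℕ) : ℕ :=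
  Nat.findGreatest (fun ℓ => Lstar.circuitSize ℓ ≤ s₁ n) (s₂ n)

variable {Lstar Ldiag : Language Bool} {s s₁ s₂ : ℕ → ℕ}

/-- `αₙ ≤ s₂(n)`. [cite: MurrayWilliams2018, Thm. 3.1 (display (2))] -/
theorem advice_le (n : ℕ) : advice Lstar s₁ s₂ n ≤ s₂ n :=
  Nat.findGreatest_le _

/-- Maximality of `ℓ(n)`: every `ℓ ≤ s₂(n)` at which `Lstar` has an `s₁(n)`-size circuit is at
most `αₙ`. [cite: MurrayWilliams2018, Thm. 3.1 (display (1))] -/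
theorem le_advice {n ℓ : ℕ} (hℓ : ℓ ≤ s₂ n) (h : Lstar.circuitSize ℓ ≤ s₁ n) :
    ℓ ≤ advice Lstar s₁ s₂ n :=
  Nat.le_findGreatest hℓ h

/-- The advice guarantees that the guessed circuits exist: `Lstar^{αₙ}` has a `B₂`-circuit of
size at most `s₁(n)` (for `s₁(n) ≥ 1`). [cite: MurrayWilliams2018, Thm. 3.1 (proof)] -/
theorem circuitSize_advice_le {n : ℕ} (h1 : 1 ≤ s₁ n) :
    Lstar.circuitSize (advice Lstar s₁ s₂ n) ≤ s₁ n :=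
  circuitSize_findGreatest_le h1 _

/-! ### The language `L₁` of the protocol `M₁` -/

/-- **Murray–Williams' hard language `L₁`** (Thm. 3.1), as the language the protocol `M₁` with
advice `αₙ` decides under its promise: on length `n`, if `αₙ = s₂(n)` it is the diagonal
language `Ldiag` ("simulate `L_diag` on `y`"), otherwise it consists of the words `y = 1ᵃ0x`
with `|x| + 1 ≤ αₙ` and `1^{αₙ-|x|-1}0x ∈ Lstar` ("simulate `L_PSPACE` on a padded input").
[cite: MurrayWilliams2018, Thm. 3.1 (the protocol M₁)] -/
def hardLang (Lstar Ldiag : Language Bool) (s₁ s₂ : ℕ → ℕ) : Language Bool :=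
  {y | (advice Lstar s₁ s₂ y.length = s₂ y.length ∧ y ∈ Ldiag) ∨
    (advice Lstar s₁ s₂ y.length < s₂ y.length ∧
      ∃ (a : ℕ) (x : List Bool), y = List.replicate a true ++ false :: x ∧
        x.length + 1 ≤ advice Lstar s₁ s₂ y.length ∧
        List.replicate (advice Lstar s₁ s₂ y.length - (x.length + 1)) true ++ false :: x ∈ Lstar)}

/-- First branch: on a length with `αₙ = s₂(n)`, `L₁` is `Ldiag`.
[cite: MurrayWilliams2018, Thm. 3.1 (the protocol M₁)] -/
theorem mem_hardLang_iff_of_eq {n : ℕ} (hα : advice Lstar s₁ s₂ n = s₂ n)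
    (y : List Bool) (hy : y.length = n) : y ∈ hardLang Lstar Ldiag s₁ s₂ ↔ y ∈ Ldiag := by
  subst hy
  simp only [hardLang]
  constructor
  · rintro (⟨-, h⟩ | ⟨h, -⟩)
    · exact h
    · omega
  · exact fun h => Or.inl ⟨hα, h⟩

/-- Second branch: on a length with `αₙ < s₂(n)`, `L₁` is the padded `Lstar`.
[cite: MurrayWilliams2018, Thm. 3.1 (the protocol M₁)] -/
theorem mem_hardLang_iff_of_lt {n : ℕ} (hα : advice Lstar s₁ s₂ n < s₂ n)
    (y : List Bool) (hy : y.length = n) :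
    y ∈ hardLang Lstar Ldiag s₁ s₂ ↔
      ∃ (a : ℕ) (x : List Bool), y = List.replicate a true ++ false :: x ∧
        x.length + 1 ≤ advice Lstar s₁ s₂ n ∧
        List.replicate (advice Lstar s₁ s₂ n - (x.length + 1)) true ++ false :: x ∈ Lstar := by
  subst hy
  simp only [hardLang]
  constructor
  · rintro (⟨h, -⟩ | ⟨-, h⟩)
    · omega
    · exact h
  · exact fun h => Or.inr ⟨hα, h⟩

/-- The second branch through paddability: if `1z ∈ Lstar ⟺ z ∈ Lstar` and no all-ones word is
in `Lstar`, then on a length `n` with `αₙ < s₂(n)`, `1ʲ z ∈ L₁ ⟺ z ∈ Lstar` whenever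
`j + |z| = n` and `|z| ≤ αₙ` (the interface `hL1b` of `eventually_lt_circuitSize_or`).
[cite: MurrayWilliams2018, Thm. 3.1 (proof)] -/
theorem replicate_append_mem_hardLang_iff
    (hpad : ∀ z : List Bool, true :: z ∈ Lstar ↔ z ∈ Lstar)
    (hones : ∀ b : ℕ, List.replicate b true ∉ Lstar)
    {n : ℕ} (hα : advice Lstar s₁ s₂ n < s₂ n) (j : ℕ) (z : List Bool) (hjz : j + z.length = n)
    (hz : z.length ≤ advice Lstar s₁ s₂ n) :
    List.replicate j true ++ z ∈ hardLang Lstar Ldiag s₁ s₂ ↔ z ∈ Lstar :=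
  replicate_append_mem_iff_of_branch hpad hones (mem_hardLang_iff_of_lt hα) j z hjz hz

/-- **Theorem 3.1, hardness half, for the explicit language `L₁`.** For a paddable language
`Lstar` without all-ones words, downward self-reducible in circuit form with overhead `D`
(`hdsr`), a language `Ldiag` without `s(n)`-size circuits at large lengths (Thm. 2.3), and size
functions with, eventually, `n ≤ s₂(n)`, (ii) `s(s₂ n) + 2 ≤ s₁(n)` and (iii)
`D ℓ (s(m) + 2) ≤ s₁(m)` for `ℓ < m`: for all sufficiently large `n`, the circuit complexity of
`hardLang Lstar Ldiag s₁ s₂` exceeds `s(n)` at length `n` or `s(s₂ n)` at length `s₂ n`.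
[cite: MurrayWilliams2018, Thm. 3.1] -/
theorem eventually_lt_circuitSize_hardLang_or {D : ℕ → ℕ → ℕ}
    (hpad : ∀ z : List Bool, true :: z ∈ Lstar ↔ z ∈ Lstar)
    (hones : ∀ b : ℕ, List.replicate b true ∉ Lstar)
    (hs₂ : ∀ᶠ n in atTop, n ≤ s₂ n)
    (hii : ∀ᶠ n in atTop, s (s₂ n) + 2 ≤ s₁ n)
    (hiii : ∀ᶠ m in atTop, ∀ ℓ < m, D ℓ (s m + 2) ≤ s₁ m)
    (hdsr : ∀ ℓ S : ℕ, Lstar.circuitSize ℓ ≤ S → Lstar.circuitSize (ℓ + 1) ≤ D ℓ S)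
    (hdiag : ∀ᶠ n in atTop, s n < Ldiag.circuitSize n) :
    ∀ᶠ n in atTop, s n < (hardLang Lstar Ldiag s₁ s₂).circuitSize n ∨
      s (s₂ n) < (hardLang Lstar Ldiag s₁ s₂).circuitSize (s₂ n) :=
  eventually_lt_circuitSize_or (α := advice Lstar s₁ s₂) hs₂ hii hiii hdsr advice_le
    (fun _ _ hℓ h => le_advice hℓ h) hdiag
    (Eventually.of_forall fun _ hα => mem_hardLang_iff_of_eq hα)
    (Eventually.of_forall fun _ hα => replicate_append_mem_hardLang_iff hpad hones hα)

end AlmostAE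

end Literature.Computability.Complexity

end
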